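import Literature.MathematicalPhysics.QuantumFieldTheory.Balaban1983to89.B11Eq183Differentiation
import Literature.MathematicalPhysics.QuantumFieldTheory.Balaban1983to89.B11Eq81Expansion
import Literature.MathematicalPhysics.QuantumFieldTheory.Balaban1983to89.B11Eq171Criticality
import Literature.MathematicalPhysics.QuantumFieldTheory.Balaban1983to89.B11Eq101Translation

/-!
# `Balaban1983to89.B11Eq177FirstOrder` — T. Bałaban, *The variational problem and background fields in renormalization group method for lattice gauge theories*, Commun. Math. Phys. **102** (1985) 277–309 [Balaban1985Variational]: Sect. G, (170) p. 305, (175)–(177) pp. 305–306, (178) p. 306 — the minimal configuration as the base point: the first variation vanishes, `𝒜₁` begins with second order and `𝓗` begins with the first order term `H₁B`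

statement-level skeleton of published theorems with citation tags; proofs where landed; nothing here is a claim about the Yang–Mills mass gap

PDF held: `paper:balaban1985-cmp102-variational-background` (journal page = PDF page + 276).  Renders
`run/shared/lean/pub/pub-balaban/b2b-balaban-ref1/pages/1985-cmp102-variational-background/…-p017-x2.png` (p. 293),
`…-p018-x2.png` (p. 294), `…-p029-x2.png` (p. 305) and `…-p030-x2.png` (p. 306) READ AS IMAGES by this seat (lit-balaban
reader/typer r08, gen 12, 2026-08-22); [Balaban1985UV3] = Commun. Math. Phys. 102 (1985) 255–275, p. 268–269 [PDF 14–15]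
from the held text layer `paper:balaban1985-cmp102-uv-stability-3d`.

CITATION HEADER (lean-in-tree rule 2026-08-18).  WHAT IS REPRODUCED: the in-text inferences of Sect. G that take the MINIMAL
configuration `U_k` as the base point `U₀` — rows `B11.Eq170` ((170)–(171) p. 305 and (178) p. 306) and `B11.Eq174`
((174)–(177) pp. 305–306) of `HOME/lit-balaban-r08/ROWS-B11.md` (HOME = `run/shared/lean/pub/lit-balaban/`) — over the
vocabulary ALREADY in the tree: the functional (81) and the variational equation (82)–(84) (`B11Eq127EulerLagrange.functional81`,
`B11Eq81Expansion.tangent83` / `IsCritical82` / `hasFDerivAt84`), the Sect. E–G contraction scheme (`B11Prop6Scheme.mapT`,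
`B11Eq174Chart.solA` / `chartH` / `Regime`) and the differentiated chart (`B11Eq183Differentiation.solA180` / `chartH179` /
`eq183` / `hasFDerivAt_chartH179`).  Nothing there is modified; no lattice object is constructed.

THE PRINT (verbatim).  p. 305 [PDF 29]: *«Let us make a remark concerning the minimal configurations U_k. If we take such a
configuration as U₀ in the expansion (74), then Eqs. (82), (99) are satisfied for A′ = 0, hence we have
  ⟨δA′, J⟩ = 0 for δA′: Q(U_k)δA′ = 0, R(U_k)D^{η*}_{U_k}δA′ = 0, (170)
where J = η^{−2} Im D^{η*}_{U_k}∂U_k. The above condition can be written simply as the equation 𝔓*(U_k)J = 0 (171)»*;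
*«The configuration 𝓗 is represented as 𝓗 = 𝒜₁ + H₁B − HD(𝒜₁ + H₁B), (174) where 𝒜₁ satisfies the equation
𝒜₁ + 𝔊((δ/δA′)V)(𝒜₁ + H₁B) = 0, (175)»*.  p. 306 [PDF 30]: *«Let us notice that it begins with a term of second order in
H₁B, more exactly we have 𝒜₁^{(2)} = −𝔊((δ/δA′)V^{(3)})(H₁B). (176) This implies that the expansion of 𝓗 begins with the
first order term H₁B. Let us write first and second order terms in it 𝓗 = H₁B − 𝔊((δ/δA′)V^{(3)})(H₁B) − HC^{(2)}(H₁B) + ⋯.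
(177)»*; *«Now let us write the alternative condition for the minimal configuration U_k … The condition follows from Eq. (127).
We take U₀ = U_k, and then it is satisfied for A′₁ = 0, hence we obtain ⟨δA′, J⟩ = 0 for δA′: Q(U_k)δA′ = 0, (178) or
P₀*(U_k)J = 0.»*  Also used: p. 294 [PDF 18] *«the operator G₁𝔓* is equal to the operator 𝔊»* with (111)
*«A₁ + 𝔊J + 𝔊((δ/δA′)V)(A₁ + H₁B) = 0»*, and p. 293 [PDF 17] (98) *«|((δ/δA′)V)(A′)|_{(−3)} ≦ C₄(max{|A′|_{(−1)},
|∇A′|_{(−2)}})²»*.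

WHAT IS CERTIFIED (kernel, sorry-free, theorems only).
 §1 (170) / (178) — the «hence»: if the functional (81) `𝔉(A′) = A(U₀) + ⟨A′, J⟩ + ½⟨A′, Δ₁A′⟩ + V(A′)` has a LOCAL MINIMUM at
    `A′ = 0` on the tangent space `T` (print: `U₀ = U_k` is minimal) and `V` has derivative `0` at `0` ((80): third and higher
    order; (98) at `A′ = 0`), then `⟨δA′, J⟩ = 0` for all `δA′ ∈ T` (`inner_J_eq_zero_of_isLocalMinOn`, via the Fermat step
    `B11Eq127EulerLagrange.eq127` at `A′₁ = 0`); with `T` = (83)/(100) this is **(170)** (`eq170`), with `T = ker Q` it is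
    **(178)** (`eq178`), and with the projection adjoint of `B11Eq171Criticality` it is **(171)** / «P₀*(U_k)J = 0»
    (`adj_J_eq_zero_of_isLocalMinOn`).  The same conclusion from the variational equation (82)/(99) at `A′ = 0`
    (`eq170_of_isCritical82`, `inner_eq_zero_of_firstVariation_zero`).
 §2 (175) is (111) at a minimal `U₀`: `𝔊 = G₁𝔓*` and (171) give `𝔊J = 0`, so the transformation (116) and its selected
    solution do not see `J` (`frakG_J_eq_zero_of_171`, `mapT_eq_of_apply_J_eq_zero`, `solA_eq_of_apply_J_eq_zero`).
 §3 (176)–(177) AS DERIVATIVE STATEMENTS in the Sect. E–G scheme (representation (174)/(175): the scheme of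
    `B11Eq183Differentiation` with `Δ⁽²⁾ := 0`, shift `𝔄 = H₁B`): `(δ/δA′)V` has derivative `0` at `0` ((98):
    `hasFDerivAt_W_zero`); `𝒜₁(0) = 0` and **`(δ/δB)𝒜₁(0) = 0`** — «it begins with a term of second order in H₁B»
    (`fderiv_solA175_zero`, `hasFDerivAt_solA175_zero`, from (183) at `B = 0`); **`(δ/δB)𝓗(0) = H₁`** — «the expansion of 𝓗
    begins with the first order term H₁B» — for every Sect. C map with derivative `1` at `0`, in particular `Y ↦ Y − H(D(Y))`
    with `D′(0) = 0` ((55)–(56)) (`hasFDerivAt_chartH175_zero`, `hasFDerivAt_chartH177_zero`).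
 §5 (v1.1, append-only) (74) AT THE MINIMAL BASE POINT: the functional (74) itself has Fréchet derivative `⟨·, J⟩` at
    `A′ = 0` whenever `HD` is of second order, `Δ_π` bounded and `V₀` at least of second order near `0`
    (`hasFDerivAt_functional74_zero`), hence **(170) from a local minimum of (74) at `A′ = 0` on the tangent space (83)**
    with only these printed-order letters (`eq170_of_isLocalMinOn_74`; Fermat along the subspace).
 §6 (v1.2, append-only) THE SAME FOR THE REPRESENTATION (179)–(180) («we have the corresponding formulas (176), (177)»,
    p. 306), where `−Δ⁽²⁾H₀B` is a source: `𝒜₀(0) = 0`, `(δ/δB)𝒜₀(0) = G̃Δ⁽²⁾H₀` (`fderiv_solA180_zero`), `(δ/δB)𝓗(0) =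
    G̃Δ⁽²⁾H₀ + H₀` (`hasFDerivAt_chartH179_zero(_of_D)`), and the action along the chart (`hasFDerivAt_action_chart179_zero`).
 §7 (v1.3, append-only; asked by r07 g16) THE OTHER TWO «ORTHOGONALITY RELATIONS» OF [Balaban1985UV3] (53) LOCATED IN
    [7], over real inner-product letters: `⟨𝒜₁, J⟩ = 0` because a solution of (175) lies in the space (109) («Q𝔊 = 0,
    RD*𝔊 = 0» p. 294) on which `J` vanishes by (170) (`inner_frakG_J_eq_zero`, `solution175_mem_tangent`,
    `inner_solution175_J_eq_zero`); the cross term `⟨H₁b, Δ₁𝒜₁⟩ = 0` from the symmetry of `Δ₁` and the p. 293 identity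
    «⟨δA′, Δ₁H₁B⟩ = 0» (`inner_H1_delta1_eq_zero`; with the identity supplied by `B11Eq101Translation.inner_delta1_H1_eq_zero`:
    `inner_hOp_delta1_eq_zero`).  + import `B11Eq101Translation`.
 §4 THE FIRST-ORDER TERM OF THE ACTION ALONG THE CHART: for any real-differentiable `𝔉` on the field space with derivative `φ`
    at `0` (print: (81)/(84) at `A′ = 0`, `φ = ⟨·, J⟩`), `B ↦ 𝔉(𝒜₁(B) + H₁B)` (= `A(exp(iη𝓗(B))U₀)` by (74), (174)) has
    derivative `φ ∘ H₁` at `B = 0` (`hasFDerivAt_action_chart_zero`), i.e. `𝔉(𝒜₁(B) + H₁B) = 𝔉(0) + φ(H₁B) + q(B)` with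
    `q′(0) = 0` (`expansion_firstOrder`), also after an inner substitution `B = A − D̃(A)` with `D̃(0) = 0`, `D̃′(0) = 0`
    (`expansion_firstOrder_comp`) — LITERALLY the hypotheses `h26`/`hq` of `B10Eq19LinearTerm.inner_J_eq_zero_of_expansion26`
    (r07), whose conclusion under the minimality of [Balaban1985UV3] p. 268 («We take the minimal configuration V^{(k)} of the
    functional A^η(U_k) …») is `⟨H₁A, J⟩ = 0` on the constraint space — the first of the «orthogonality relations» used in
    [Balaban1985UV3] (53) p. 269 (`B10SectCExpansion.Orthogonality53`, third member).  No B10 module is imported here.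

HONEST SCOPE — what is NOT claimed.  (i) The minimality of `U_k` (Theorem 1) and the identification of «𝔉 has a local
minimum at A′ = 0 on T» with it (Props. 2–3: the chart (47) covers the space (6) near `U₀` with the same average data) are
HYPOTHESES in printed shape (`IsLocalMinOn …`), as are the regime letters of Prop. 6 (`Regime`), Prop. 4's analyticity of
`(δ/δA′)V` (`hWa`) and, in §4, the derivative `φ` of `𝔉` at `0`.  (ii) The display (176) itself (the quadratic term
`−𝔊((δ/δA′)V^{(3)})(H₁B)`) and the second-order terms of (177) are `B11Eq176Expansion` / `B11Eq177SecondOrder` (norm form);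
here only the ORDERS are certified, as exact derivative statements at `B = 0`.  (iii) The other two «orthogonality relations» of
[Balaban1985UV3] (53) (`⟨𝒜₁, J⟩ = 0`: `𝒜₁ ∈ ker Q ∩ ker RD*` by `Q𝔊 = 0`, `RD*𝔊 = 0` p. 294 with (170); the cross term
`⟨H₁B′, Δ₁𝒜₁⟩ = 0`: the identity «⟨δA′, Δ₁H₁B⟩ = 0» p. 293, `B11Eq101Translation.inner_delta1_H1_eq_zero`) are located here in
prose only.  (iv) Complex Banach spaces `𝒳` (data `B`), `𝒴` (fields), `𝒵` (sources) as in `B11Prop6Scheme` (D-B11-20); the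
real structure used in §4 is the restriction of scalars.  Nothing here is progress on the summit `Summit.QuantumFields`.
Mega-formalization `lit-balaban`, reader/typer seat r08 gen 12 (unit `lit-balaban-r08`, B11 fold owner); 0 sorry, 0 new named
facts (theorems over hypothesis binders only).
-/

namespace Literature.MathematicalPhysics.QuantumFieldTheory.Balaban1983to89.B11Eq177FirstOrder

open Metric Set Filter Topology
open scoped InnerProductSpace
open Literature.MathematicalPhysics.QuantumFieldTheory.Balaban1983to89
open B11Prop6Scheme B11Eq174Chart B11Eq183Differentiation
open Literature.MathematicalPhysics.QuantumFieldTheory.Balaban1983to89.B11Eq127EulerLagrange (functional81 eq127)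
open Literature.MathematicalPhysics.QuantumFieldTheory.Balaban1983to89.B11Eq81Expansion (tangent83 mem_tangent83_iff
  IsCritical82 hasFDerivAt84_apply)
open Literature.MathematicalPhysics.QuantumFieldTheory.Balaban1983to89.B13Contraction113 (QuadAnalytic)

/-! ## §0 A calculus lemma: a map bounded by `C‖A‖²` near `0` has derivative `0` at `0` -/

section Calculus

variable {𝕜 : Type*} [NontriviallyNormedField 𝕜] {E F : Type*} [NormedAddCommGroup E] [NormedSpace 𝕜 E]
  [NormedAddCommGroup F] [NormedSpace 𝕜 F]

/-- If `‖q(A)‖ ≦ C‖A‖²` for `A` near `0`, then `q(0) = 0` and `q` has Fréchet derivative `0` at `0` (a quadratic bound is a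
little-o of `‖A‖`). [folklore] -/
private theorem hasFDerivAt_zero_of_eventually_norm_le_sq {q : E → F} {C : ℝ}
    (hq : ∀ᶠ A in 𝓝 (0 : E), ‖q A‖ ≤ C * ‖A‖ ^ 2) : HasFDerivAt q (0 : E →L[𝕜] F) 0 := by
  have hq0 : q 0 = 0 := by
    have h : ‖q 0‖ ≤ C * ‖(0 : E)‖ ^ 2 := hq.self_of_nhds
    rw [norm_zero, zero_pow two_ne_zero, mul_zero] at h
    exact norm_le_zero_iff.1 h
  rw [hasFDerivAt_iff_isLittleO_nhds_zero]
  simp only [zero_add, hq0, sub_zero, zero_apply]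
  refine Asymptotics.IsLittleO.of_bound fun ε hε => ?_
  have hC : 0 < max C 1 := lt_max_of_lt_right one_pos
  filter_upwards [hq, Metric.ball_mem_nhds (0 : E) (div_pos hε hC)] with h hh hb
  rw [mem_ball_zero_iff] at hb
  calc ‖q h‖ ≤ C * ‖h‖ ^ 2 := hh
    _ ≤ max C 1 * ‖h‖ ^ 2 := mul_le_mul_of_nonneg_right (le_max_left C 1) (by positivity)
    _ = (max C 1 * ‖h‖) * ‖h‖ := by ring
    _ ≤ (max C 1 * (ε / max C 1)) * ‖h‖ := by gcongr
    _ = ε * ‖h‖ := by field_simp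

end Calculus

/-! ## §1 (170) and (178): at a minimal `U₀ = U_k` the first variation `⟨δA′, J⟩` vanishes on the tangent space -/

section FirstVariation

variable {E F : Type*} [NormedAddCommGroup E] [InnerProductSpace ℝ E] [NormedAddCommGroup F]
  [InnerProductSpace ℝ F]
variable {S : Type*} [AddCommGroup S] [Module ℝ S]

/-- The variational equation ((82) with (84), i.e. (99), or (127)) AT `A′ = 0` with `((δ/δA′)V)(0) = 0` reads `⟨δA′, J⟩ = 0`
on the space of admissible variations `T` — the «hence» of (170) p. 305 and of (178) p. 306.
[cite: Balaban1985Variational, (170) p.305, (178) p.306] -/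
theorem inner_eq_zero_of_firstVariation_zero (T : Submodule ℝ E) {J : E} {Δ₁ : E →ₗ[ℝ] E} {DV : E →L[ℝ] ℝ}
    (h : ∀ δ ∈ T, ⟪δ, J⟫_ℝ + ⟪δ, Δ₁ 0⟫_ℝ + DV δ = 0) (hDV : DV = 0) : ∀ δ ∈ T, ⟪δ, J⟫_ℝ = 0 := by
  intro δ hδ
  have h' := h δ hδ
  rwa [map_zero, inner_zero_right, add_zero, hDV, zero_apply, add_zero] at h'

/-- **(170) from (82)**: «Eqs. (82), (99) are satisfied for A′ = 0, hence we have ⟨δA′, J⟩ = 0 for δA′: Q(U_k)δA′ = 0,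
R(U_k)D^{η*}_{U_k}δA′ = 0» — if `A′ = 0` is critical for (81) on the tangent space (83) (the derivative (84) at `A′ = 0` being
`⟨·, J⟩ + ⟨·, Δ₁0⟩ + ((δ/δA′)V)(0)` with `((δ/δA′)V)(0) = 0`), then `J` is orthogonal to every `δA′` with `QδA′ = 0`, `RD*δA′ = 0`.
[cite: Balaban1985Variational, (170) p.305, (82)–(84) p.290] -/
theorem eq170_of_isCritical82 (Q : E →ₗ[ℝ] F) (R : S →ₗ[ℝ] S) (Dstar : E →ₗ[ℝ] S) {J : E} {Δ₁ : E →L[ℝ] E}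
    {DV : E →L[ℝ] ℝ} (h82 : IsCritical82 (innerSL ℝ J + innerSL ℝ (Δ₁ 0) + DV) (tangent83 Q R Dstar))
    (hDV : DV = 0) : ∀ δ : E, Q δ = 0 → R (Dstar δ) = 0 → ⟪δ, J⟫_ℝ = 0 := by
  intro δ hQ hR
  have hmem : δ ∈ tangent83 Q R Dstar := (mem_tangent83_iff Q R Dstar δ).2 ⟨hQ, hR⟩
  have h := h82 δ hmem
  rw [hasFDerivAt84_apply] at h
  rwa [map_zero, inner_zero_right, add_zero, hDV, zero_apply, add_zero] at h

/-- A local minimum of `f` at `0` on (the carrier of) a subspace `T` is a local minimum of `t ↦ f(0 + tδ)` at `t = 0` for every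
direction `δ ∈ T` (the line stays in `T`). [folklore] -/
private theorem isLocalMin_line_of_isLocalMinOn {f : E → ℝ} {T : Submodule ℝ E}
    (hmin : IsLocalMinOn f (T : Set E) 0) {δ : E} (hδ : δ ∈ T) :
    IsLocalMin (fun t : ℝ => f (0 + t • δ)) 0 := by
  have hg : Tendsto (fun t : ℝ => (0 : E) + t • δ) (𝓝 0) (𝓝[(T : Set E)] 0) := by
    refine tendsto_nhdsWithin_iff.2 ⟨?_, Filter.Eventually.of_forall fun t => ?_⟩
    · have hc : Continuous fun t : ℝ => (0 : E) + t • δ := by fun_prop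
      simpa using hc.tendsto 0
    · simpa using T.smul_mem t hδ
  have hev : ∀ᶠ t in 𝓝 (0 : ℝ), f 0 ≤ f ((0 : E) + t • δ) := hg.eventually hmin
  show ∀ᶠ t in 𝓝 (0 : ℝ), f ((0 : E) + (0 : ℝ) • δ) ≤ f ((0 : E) + t • δ)
  simpa using hev

/-- **Minimal base point ⇒ `J ⟂ T`**: if the functional (81) `𝔉(A′) = A(U₀) + ⟨A′, J⟩ + ½⟨A′, Δ₁A′⟩ + V(A′)` (`Δ₁` symmetric, `V` with
derivative `0` at `0` — (80): «higher order terms», (98) at `A′ = 0`) has a local minimum at `A′ = 0` on a subspace `T` of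
variations (print: «If we take such a configuration [the minimal U_k] as U₀ in the expansion (74), then Eqs. (82), (99) are
satisfied for A′ = 0»), then `⟨δA′, J⟩ = 0` for every `δA′ ∈ T` — the Fermat step (127) at `A′₁ = 0`
(`B11Eq127EulerLagrange.eq127`). [cite: Balaban1985Variational, (170) p.305, (127) p.297] -/
theorem inner_J_eq_zero_of_isLocalMinOn {c : ℝ} {J : E} {Δ₁ : E →ₗ[ℝ] E}
    (hΔ : ∀ x y, ⟪Δ₁ x, y⟫_ℝ = ⟪x, Δ₁ y⟫_ℝ) {V : E → ℝ} (hV : HasFDerivAt V (0 : E →L[ℝ] ℝ) 0)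
    (T : Submodule ℝ E) (hmin : IsLocalMinOn (functional81 c J Δ₁ V) (T : Set E) 0) :
    ∀ δ ∈ T, ⟪δ, J⟫_ℝ = 0 := by
  have h127 := eq127 (c := c) (A₁ := 0) hΔ hV T fun δ hδ => isLocalMin_line_of_isLocalMinOn hmin hδ
  exact inner_eq_zero_of_firstVariation_zero T h127 rfl

/-- **(170)** p. 305: for the minimal `U₀ = U_k` — `𝔉` of (81) locally minimal at `A′ = 0` on the tangent space (83)/(100)
`{δA′ : QδA′ = 0, RD*δA′ = 0}` — «⟨δA′, J⟩ = 0 for δA′: Q(U_k)δA′ = 0, R(U_k)D^{η*}_{U_k}δA′ = 0. (170)».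
[cite: Balaban1985Variational, (170) p.305] -/
theorem eq170 {c : ℝ} {J : E} {Δ₁ : E →ₗ[ℝ] E} (hΔ : ∀ x y, ⟪Δ₁ x, y⟫_ℝ = ⟪x, Δ₁ y⟫_ℝ) {V : E → ℝ}
    (hV : HasFDerivAt V (0 : E →L[ℝ] ℝ) 0) (Q : E →ₗ[ℝ] F) (R : S →ₗ[ℝ] S) (Dstar : E →ₗ[ℝ] S)
    (hmin : IsLocalMinOn (functional81 c J Δ₁ V) (tangent83 Q R Dstar : Set E) 0) :
    ∀ δ : E, Q δ = 0 → R (Dstar δ) = 0 → ⟪δ, J⟫_ℝ = 0 := fun δ hQ hR =>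
  inner_J_eq_zero_of_isLocalMinOn hΔ hV _ hmin δ ((mem_tangent83_iff Q R Dstar δ).2 ⟨hQ, hR⟩)

/-- **(178)** p. 306: «The condition follows from Eq. (127). We take U₀ = U_k, and then it is satisfied for A′₁ = 0, hence we obtain
⟨δA′, J⟩ = 0 for δA′: Q(U_k)δA′ = 0, (178)» — the same Fermat step on the space `{δA′ : QδA′ = 0}` (no gauge condition), with the
operator `Δ − Δ^{(2)}` of (127) in the place of `Δ₁`. [cite: Balaban1985Variational, (178) p.306, (127) p.297] -/
theorem eq178 {c : ℝ} {J : E} {Δ : E →ₗ[ℝ] E} (hΔ : ∀ x y, ⟪Δ x, y⟫_ℝ = ⟪x, Δ y⟫_ℝ) {V : E → ℝ}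
    (hV : HasFDerivAt V (0 : E →L[ℝ] ℝ) 0) (Q : E →ₗ[ℝ] F)
    (hmin : IsLocalMinOn (functional81 c J Δ V) (LinearMap.ker Q : Set E) 0) :
    ∀ δ : E, Q δ = 0 → ⟪δ, J⟫_ℝ = 0 := fun δ hQ =>
  inner_J_eq_zero_of_isLocalMinOn hΔ hV _ hmin δ (LinearMap.mem_ker.2 hQ)

/-- **(171) / «P₀*(U_k)J = 0»**: with a projection `P` onto the space of variations `T` and its adjoint `Padj` (print's `𝔓*(U_k)`,
resp. `P₀*(U_k)` for `T = ker Q`), the minimality gives `Padj J = 0` (`B11Eq171Criticality.criticality_iff_adj_eq_zero`).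
[cite: Balaban1985Variational, (171) p.305, (178) p.306] -/
theorem adj_J_eq_zero_of_isLocalMinOn {c : ℝ} {J : E} {Δ₁ : E →ₗ[ℝ] E}
    (hΔ : ∀ x y, ⟪Δ₁ x, y⟫_ℝ = ⟪x, Δ₁ y⟫_ℝ) {V : E → ℝ} (hV : HasFDerivAt V (0 : E →L[ℝ] ℝ) 0)
    (T : Submodule ℝ E) (hmin : IsLocalMinOn (functional81 c J Δ₁ V) (T : Set E) 0)
    {P Padj : E →ₗ[ℝ] E} (hPT : ∀ x : E, P x ∈ T) (hPid : ∀ δ ∈ T, P δ = δ)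
    (hadj : ∀ x y : E, ⟪P x, y⟫_ℝ = ⟪x, Padj y⟫_ℝ) : Padj J = 0 :=
  (B11Eq171Criticality.criticality_iff_adj_eq_zero T hPT hPid hadj J).1
    (inner_J_eq_zero_of_isLocalMinOn hΔ hV T hmin)

end FirstVariation

/-! ## §2 (175) is (111) at a minimal `U₀`: the term `𝔊J` is absent -/

section Eq175

variable {𝒴 𝒵 𝒲 : Type*} [NormedAddCommGroup 𝒴] [NormedSpace ℂ 𝒴] [NormedAddCommGroup 𝒵] [NormedSpace ℂ 𝒵]
  [NormedAddCommGroup 𝒲] [NormedSpace ℂ 𝒲]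

/-- «In [5] we have proved that the operator G₁𝔓* is equal to the operator 𝔊» (p. 294) and «𝔓*(U_k)J = 0 (171)» (p. 305): at a
minimal `U₀ = U_k` the source term of (111)/(116) vanishes, `𝔊J = G₁(𝔓*J) = 0`.
[cite: Balaban1985Variational, (111) p.294, (171) p.305] -/
theorem frakG_J_eq_zero_of_171 {𝔊 : 𝒵 →L[ℂ] 𝒴} {G₁ : 𝒲 →L[ℂ] 𝒴} {Padj : 𝒵 →L[ℂ] 𝒲}
    (h𝔊 : 𝔊 = G₁ ∘L Padj) {J : 𝒵} (h171 : Padj J = 0) : 𝔊 J = 0 := by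
  rw [h𝔊, ContinuousLinearMap.comp_apply, h171, map_zero]

/-- With `𝔊J = 0` the transformation (116) `X ↦ −𝔊J + Λ(X + 𝔄) − 𝔊((δ/δA′)V)(X + 𝔄)` is the one WITHOUT source — (111) becomes
(175) «𝒜₁ + 𝔊((δ/δA′)V)(𝒜₁ + H₁B) = 0». [cite: Balaban1985Variational, (175) p.305, (116) p.295] -/
theorem mapT_eq_of_apply_J_eq_zero {𝒢 : 𝒵 →L[ℂ] 𝒴} {J : 𝒵} (hJ : 𝒢 J = 0) (Λ : 𝒴 →L[ℂ] 𝒴) (W : 𝒴 → 𝒵)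
    (𝔄 X : 𝒴) : mapT 𝒢 Λ W J 𝔄 X = mapT 𝒢 Λ W 0 𝔄 X := by
  rw [mapT_apply, mapT_apply, hJ, map_zero]

/-- … hence the selected solution `𝒜` of (111) in the ball (115) IS the selected solution `𝒜₁` of (175).
[cite: Balaban1985Variational, (175) p.305, (111) p.294] -/
theorem solA_eq_of_apply_J_eq_zero {𝒢 : 𝒵 →L[ℂ] 𝒴} {J : 𝒵} (hJ : 𝒢 J = 0) (Λ : 𝒴 →L[ℂ] 𝒴) (W : 𝒴 → 𝒵)
    (ε₄ : ℝ) (𝔄 : 𝒴) : solA 𝒢 Λ W J ε₄ 𝔄 = solA 𝒢 Λ W 0 ε₄ 𝔄 := by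
  unfold solA
  simp only [mapT_eq_of_apply_J_eq_zero hJ]

end Eq175

/-! ## §3 (176)–(177): `𝒜₁` begins with second order in `H₁B`, `𝓗` begins with the first order term `H₁B` -/

section Scheme

variable {𝒳 𝒴 𝒵 : Type*} [NormedAddCommGroup 𝒳] [NormedSpace ℂ 𝒳] [NormedAddCommGroup 𝒴] [NormedSpace ℂ 𝒴]
  [NormedAddCommGroup 𝒵] [NormedSpace ℂ 𝒵]
variable {𝒢 : 𝒵 →L[ℂ] 𝒴} {W : 𝒴 → 𝒵} {H₁ : 𝒳 →L[ℂ] 𝒴} {B₀ θ C₄ a₃ j a ε₄ : ℝ}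

/-- **(98) at `A′ = 0`**: `W = (δ/δA′)V`, bounded by `C₄‖Y‖²` on the ball `‖Y‖ < a₃` (Proposition 4), has Fréchet derivative `0`
at `0` (and `W(0) = 0`). [cite: Balaban1985Variational, (98) p.293] -/
theorem hasFDerivAt_W_zero {C₄ a₃ : ℝ} (hW : QuadAnalytic W C₄ a₃) (ha₃ : 0 < a₃) :
    HasFDerivAt W (0 : 𝒴 →L[ℂ] 𝒵) 0 := by
  refine hasFDerivAt_zero_of_eventually_norm_le_sq (C := C₄) ?_
  filter_upwards [Metric.ball_mem_nhds (0 : 𝒴) ha₃] with Y hY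
  exact hW.quad Y (mem_ball_zero_iff.1 hY)

/-- (98) at `A′ = 0` for `fderiv`: `((δ²/δA′²)V)(0) = 0`. [cite: Balaban1985Variational, (98) p.293] -/
theorem fderiv_W_zero {C₄ a₃ : ℝ} (hW : QuadAnalytic W C₄ a₃) (ha₃ : 0 < a₃) : fderiv ℂ W 0 = 0 :=
  (hasFDerivAt_W_zero hW ha₃).fderiv

/-- The representation (174)/(175) is the scheme of `B11Eq183Differentiation` with `Δ⁽²⁾ := 0` and shift `𝔄 = H₁B`:
`𝒜₁(B) = solA 𝔊 0 ((δ/δA′)V) 0 ε₄ (H₁B)`, the selected solution of (175) in the ball (115).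
[cite: Balaban1985Variational, (174)–(175) p.305] -/
theorem solA175_eq (B : 𝒳) : solA180 𝒢 W 0 H₁ ε₄ B = solA 𝒢 0 W 0 ε₄ (H₁ B) := by
  rw [solA180_def, zero_apply, neg_zero]

/-- … and `𝓗(B) = Tm(𝒜₁(B) + H₁B)` is the chart (174) `B11Eq174Chart.chartH` at these data.
[cite: Balaban1985Variational, (174) p.305] -/
theorem chartH174_eq (Tm : 𝒴 → 𝒴) (B : 𝒳) :
    chartH179 𝒢 W 0 H₁ Tm ε₄ B = chartH 𝒢 0 W 0 Tm ε₄ (H₁ B) := by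
  rw [chartH179, zero_apply, neg_zero]

variable [CompleteSpace 𝒴]

/-- `𝒜₁(0) = 0` (`B = 0`, i.e. `V′ = 1`: `0` solves (175) and the solution in the ball is unique, Prop. 6).
[cite: Balaban1985Variational, (175) p.305, Prop. 6 p.295] -/
theorem solA175_zero (R : Regime 𝒢 0 W B₀ θ C₄ a₃ j a ε₄) (hj : 0 ≤ j) (ha : 0 < a) :
    solA180 𝒢 W 0 H₁ ε₄ 0 = 0 := by
  rw [solA175_eq, map_zero]
  exact R.solA_zero hj ha

variable [CompleteSpace 𝒳] [CompleteSpace 𝒵]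

/-- **(176): «it begins with a term of second order in H₁B»** as a derivative statement — `(δ/δB)𝒜₁(0) = 0`: differentiate (175)
(`B11Eq183Differentiation.eq183` with `Δ⁽²⁾ = 0`) at `B = 0`, where `𝒜₁(0) + H₁0 = 0` and `((δ²/δA′²)V)(0) = 0`.
[cite: Balaban1985Variational, (176) p.306, (183) p.307] -/
theorem fderiv_solA175_zero (R : Regime 𝒢 0 W B₀ θ C₄ a₃ j a ε₄) (hWa : AnalyticOnNhd ℂ W {Y : 𝒴 | ‖Y‖ < a₃})
    (hj : 0 < j) (ha : 0 < a) : fderiv ℂ (solA180 𝒢 W 0 H₁ ε₄) 0 = 0 := by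
  have hJ : ‖(0 : 𝒴 →L[ℂ] 𝒵) (H₁ 0)‖ < j := by simpa using hj
  have h𝔄 : ‖H₁ (0 : 𝒳)‖ < a := by simpa using ha
  have ha₃ : 0 < a₃ := by linarith [R.dom, R.ε₄_nonneg]
  have h := eq183 R hWa hJ h𝔄
  rw [solA175_zero R hj.le ha, map_zero, add_zero, fderiv_W_zero R.quad ha₃] at h
  simpa using h

/-- (176) as `HasFDerivAt`: `B ↦ 𝒜₁(B)` has Fréchet derivative `0` at `B = 0`. [cite: Balaban1985Variational, (176) p.306] -/
theorem hasFDerivAt_solA175_zero (R : Regime 𝒢 0 W B₀ θ C₄ a₃ j a ε₄)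
    (hWa : AnalyticOnNhd ℂ W {Y : 𝒴 | ‖Y‖ < a₃}) (hj : 0 < j) (ha : 0 < a) :
    HasFDerivAt (solA180 𝒢 W 0 H₁ ε₄) (0 : 𝒳 →L[ℂ] 𝒴) 0 := by
  have hJ : ‖(0 : 𝒴 →L[ℂ] 𝒵) (H₁ 0)‖ < j := by simpa using hj
  have h𝔄 : ‖H₁ (0 : 𝒳)‖ < a := by simpa using ha
  have h := hasFDerivAt_solA180 R hWa hJ h𝔄
  rwa [fderiv_solA175_zero R hWa hj ha] at h

/-- **(177), first member: «This implies that the expansion of 𝓗 begins with the first order term H₁B»** — for every Sect. C map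
`Tm` with derivative `1` at `0`, the chart `B ↦ 𝓗(B) = Tm(𝒜₁(B) + H₁B)` of (174) has Fréchet derivative `H₁` at `B = 0`.
[cite: Balaban1985Variational, (177) p.306, (174) p.305] -/
theorem hasFDerivAt_chartH175_zero (R : Regime 𝒢 0 W B₀ θ C₄ a₃ j a ε₄)
    (hWa : AnalyticOnNhd ℂ W {Y : 𝒴 | ‖Y‖ < a₃}) (hj : 0 < j) (ha : 0 < a) {Tm : 𝒴 → 𝒴}
    (hTm : HasFDerivAt Tm (ContinuousLinearMap.id ℂ 𝒴) 0) :
    HasFDerivAt (chartH179 𝒢 W 0 H₁ Tm ε₄) H₁ 0 := by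
  have hJ : ‖(0 : 𝒴 →L[ℂ] 𝒵) (H₁ 0)‖ < j := by simpa using hj
  have h𝔄 : ‖H₁ (0 : 𝒳)‖ < a := by simpa using ha
  have hTm' : HasFDerivAt Tm (ContinuousLinearMap.id ℂ 𝒴) (solA180 𝒢 W 0 H₁ ε₄ 0 + H₁ 0) := by
    rwa [solA175_zero R hj.le ha, map_zero, add_zero]
  have h := hasFDerivAt_chartH179 R hWa hJ h𝔄 hTm'
  rwa [fderiv_solA175_zero R hWa hj ha, zero_add, ContinuousLinearMap.id_comp] at h

/-- **(177)** with the Sect. C map `A′ ↦ A′ − HD(A′)` of (47)/(174): since `D` begins with the second order term ((55)–(56):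
`D′(0) = 0`), `B ↦ 𝓗(B) = 𝒜₁ + H₁B − HD(𝒜₁ + H₁B)` has Fréchet derivative `H₁` at `B = 0` — the term «H₁B» of (177).
[cite: Balaban1985Variational, (177) p.306, (55)–(56) p.286] -/
theorem hasFDerivAt_chartH177_zero {𝒲 : Type*} [NormedAddCommGroup 𝒲] [NormedSpace ℂ 𝒲]
    (R : Regime 𝒢 0 W B₀ θ C₄ a₃ j a ε₄) (hWa : AnalyticOnNhd ℂ W {Y : 𝒴 | ‖Y‖ < a₃}) (hj : 0 < j) (ha : 0 < a)
    {D : 𝒴 → 𝒲} (H : 𝒲 →L[ℂ] 𝒴) (hD : HasFDerivAt D (0 : 𝒴 →L[ℂ] 𝒲) 0) :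
    HasFDerivAt (chartH179 𝒢 W 0 H₁ (fun Y : 𝒴 => Y - H (D Y)) ε₄) H₁ 0 := by
  refine hasFDerivAt_chartH175_zero R hWa hj ha ?_
  have h := (hasFDerivAt_id (𝕜 := ℂ) (0 : 𝒴)).sub (H.hasFDerivAt.comp (0 : 𝒴) hD)
  rw [ContinuousLinearMap.comp_zero, sub_zero] at h
  exact h

/-! ## §4 The first-order term of the action along the chart: `⟨H₁B, J⟩` -/

/-- **The action along the chart is differentiable at `B = 0` with derivative `φ ∘ H₁`**: for a real-differentiable functional `𝔉`
on the field space with derivative `φ` at `A′ = 0` (print: the functional (74) = (81), `𝔉(A′) = A(exp(iη(A′ − HD(A′)))U₀)`, whose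
derivative at `A′ = 0` is `⟨·, J⟩` by (84) and (98)), the function `B ↦ 𝔉(𝒜₁(B) + H₁B)` (= `A(exp(iη𝓗(B))U₀)` by (174)) has
derivative `φ ∘ H₁` at `B = 0` — the chain rule with (176). [cite: Balaban1985Variational, (174)–(177) pp.305–306, (81)–(84) p.290] -/
theorem hasFDerivAt_action_chart_zero (R : Regime 𝒢 0 W B₀ θ C₄ a₃ j a ε₄)
    (hWa : AnalyticOnNhd ℂ W {Y : 𝒴 | ‖Y‖ < a₃}) (hj : 0 < j) (ha : 0 < a) {𝔉 : 𝒴 → ℝ} {φ : 𝒴 →L[ℝ] ℝ}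
    (h𝔉 : HasFDerivAt 𝔉 φ 0) :
    HasFDerivAt (fun B : 𝒳 => 𝔉 (solA180 𝒢 W 0 H₁ ε₄ B + H₁ B)) (φ ∘L (H₁.restrictScalars ℝ)) 0 := by
  have h1 : HasFDerivAt (fun B : 𝒳 => solA180 𝒢 W 0 H₁ ε₄ B + H₁ B) ((0 : 𝒳 →L[ℂ] 𝒴) + H₁) 0 :=
    (hasFDerivAt_solA175_zero R hWa hj ha).add H₁.hasFDerivAt
  rw [zero_add] at h1
  have h1' : HasFDerivAt (fun B : 𝒳 => solA180 𝒢 W 0 H₁ ε₄ B + H₁ B) (H₁.restrictScalars ℝ) 0 :=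
    h1.restrictScalars ℝ
  have h0 : solA180 𝒢 W 0 H₁ ε₄ 0 + H₁ 0 = 0 := by rw [solA175_zero R hj.le ha, map_zero, add_zero]
  have h𝔉' : HasFDerivAt 𝔉 φ (solA180 𝒢 W 0 H₁ ε₄ 0 + H₁ 0) := by rwa [h0]
  exact h𝔉'.comp 0 h1'

/-- **The expansion begins `𝔉(0) + φ(H₁B) + (second and higher order)`**: with `f(B) = 𝔉(𝒜₁(B) + H₁B)` there is `q` with `q′(0) = 0`
and `f(B) = 𝔉(0) + φ(H₁B) + q(B)` for all `B` (print: `A(U_k(V′V₀)) = A(U₀) + ⟨H₁B, J⟩ + …`, the expansion (81) at the argument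
(174) whose first order term is `H₁B` by (177)). [cite: Balaban1985Variational, (174)–(177) pp.305–306, (81) p.290] -/
theorem expansion_firstOrder (R : Regime 𝒢 0 W B₀ θ C₄ a₃ j a ε₄)
    (hWa : AnalyticOnNhd ℂ W {Y : 𝒴 | ‖Y‖ < a₃}) (hj : 0 < j) (ha : 0 < a) {𝔉 : 𝒴 → ℝ} {φ : 𝒴 →L[ℝ] ℝ}
    (h𝔉 : HasFDerivAt 𝔉 φ 0) :
    ∃ q : 𝒳 → ℝ, HasFDerivAt q (0 : 𝒳 →L[ℝ] ℝ) 0 ∧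
      ∀ B : 𝒳, 𝔉 (solA180 𝒢 W 0 H₁ ε₄ B + H₁ B) = 𝔉 0 + φ (H₁ B) + q B := by
  have hf := hasFDerivAt_action_chart_zero (H₁ := H₁) R hWa hj ha h𝔉
  have h0 : solA180 𝒢 W 0 H₁ ε₄ 0 + H₁ 0 = 0 := by rw [solA175_zero R hj.le ha, map_zero, add_zero]
  refine ⟨fun B => 𝔉 (solA180 𝒢 W 0 H₁ ε₄ B + H₁ B) - 𝔉 0 - φ (H₁ B), ?_, fun B => by ring⟩
  have hL : HasFDerivAt (fun B : 𝒳 => φ (H₁ B)) (φ ∘L (H₁.restrictScalars ℝ)) 0 :=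
    (φ ∘L (H₁.restrictScalars ℝ)).hasFDerivAt
  have h := (hf.sub_const (𝔉 0)).sub hL
  rw [sub_self] at h
  exact h.congr_of_eventuallyEq (Filter.Eventually.of_forall fun B => rfl)

/-- **The same after an inner substitution `B = A − D̃(A)`** with `D̃(0) = 0`, `D̃′(0) = 0` (as in [Balaban1985UV3] p. 268–269, where
`V_k = exp(i(A − D̃(A)))V^{(k)}` and the action is expanded «Using the results of Sect. G [7]»): with
`f(A) = 𝔉(𝒜₁(A − D̃A) + H₁(A − D̃A))` there is `q` with `q′(0) = 0` and `f(A) = f(0) + φ(H₁(A − D̃A)) + q(A)` for all `A` —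
verbatim the hypotheses `h26`, `hq` of `B10Eq19LinearTerm.inner_J_eq_zero_of_expansion26` with the linear functional `φ ∘ H₁`
(«⟨H₁ ·, J⟩»), whose conclusion under the minimality of `V^{(k)}` is the orthogonality relation `⟨H₁A, J⟩ = 0` of [Balaban1985UV3]
(53). [cite: Balaban1985Variational, (174)–(177) pp.305–306; Balaban1985UV3, (53) p.269] -/
theorem expansion_firstOrder_comp (R : Regime 𝒢 0 W B₀ θ C₄ a₃ j a ε₄)
    (hWa : AnalyticOnNhd ℂ W {Y : 𝒴 | ‖Y‖ < a₃}) (hj : 0 < j) (ha : 0 < a) {𝔉 : 𝒴 → ℝ} {φ : 𝒴 →L[ℝ] ℝ}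
    (h𝔉 : HasFDerivAt 𝔉 φ 0) {Dt : 𝒳 → 𝒳} (hDt0 : Dt 0 = 0) (hDt : HasFDerivAt Dt (0 : 𝒳 →L[ℝ] 𝒳) 0) :
    ∃ q : 𝒳 → ℝ, HasFDerivAt q (0 : 𝒳 →L[ℝ] ℝ) 0 ∧
      ∀ A : 𝒳, 𝔉 (solA180 𝒢 W 0 H₁ ε₄ (A - Dt A) + H₁ (A - Dt A)) =
        𝔉 (solA180 𝒢 W 0 H₁ ε₄ (0 - Dt 0) + H₁ (0 - Dt 0)) + (φ ∘L (H₁.restrictScalars ℝ)) (A - Dt A) + q A := by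
  obtain ⟨q, hq, hexp⟩ := expansion_firstOrder (H₁ := H₁) R hWa hj ha h𝔉
  have hg0 : (0 : 𝒳) - Dt 0 = 0 := by rw [hDt0, sub_zero]
  have h00 : solA180 𝒢 W 0 H₁ ε₄ 0 + H₁ 0 = 0 := by rw [solA175_zero R hj.le ha, map_zero, add_zero]
  have hg : HasFDerivAt (fun A : 𝒳 => A - Dt A) (ContinuousLinearMap.id ℝ 𝒳 - 0) 0 :=
    (hasFDerivAt_id (𝕜 := ℝ) (0 : 𝒳)).sub hDt
  have hq' : HasFDerivAt q (0 : 𝒳 →L[ℝ] ℝ) ((fun A : 𝒳 => A - Dt A) 0) := by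
    simp only [hg0]; exact hq
  have hcomp : HasFDerivAt (fun A : 𝒳 => q (A - Dt A)) ((0 : 𝒳 →L[ℝ] ℝ) ∘L (ContinuousLinearMap.id ℝ 𝒳 - 0)) 0 :=
    hq'.comp 0 hg
  rw [ContinuousLinearMap.zero_comp] at hcomp
  refine ⟨fun A => q (A - Dt A), hcomp, fun A => ?_⟩
  rw [hexp (A - Dt A), hg0, h00]
  simp only [ContinuousLinearMap.comp_apply, ContinuousLinearMap.coe_restrictScalars']

end Scheme

/-! ## §5 (v1.1) (74) at the minimal base point: the derivative of `𝔉` at `A′ = 0` is `⟨·, J⟩`; (170) from the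
minimality of `U_k` with the printed orders of `HD`, `Δ_π`, `V₀` -/

section Functional74

open Literature.MathematicalPhysics.QuantumFieldTheory.Balaban1983to89.B11Eq81Expansion (functional74)

variable {E F : Type*} [NormedAddCommGroup E] [InnerProductSpace ℝ E] [NormedAddCommGroup F]
  [InnerProductSpace ℝ F]
variable {S : Type*} [AddCommGroup S] [Module ℝ S]

/-- Fermat along a subspace for a Fréchet-differentiable function: a local minimum of `f` at `0` on (the carrier of)
`T` forces the derivative to vanish on `T` (line `t ↦ f(0 + tδ)` + `IsLocalMin.hasDerivAt_eq_zero`). [folklore] -/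
private theorem apply_eq_zero_of_isLocalMinOn {f : E → ℝ} {φ : E →L[ℝ] ℝ} (hf : HasFDerivAt f φ 0)
    {T : Submodule ℝ E} (hmin : IsLocalMinOn f (T : Set E) 0) {δ : E} (hδ : δ ∈ T) : φ δ = 0 := by
  have hl : HasDerivAt (fun t : ℝ => (0 : E) + t • δ) δ 0 := by
    simpa using ((hasDerivAt_id (0 : ℝ)).smul_const δ).const_add (0 : E)
  have hf' : HasFDerivAt f φ ((0 : E) + (0 : ℝ) • δ) := by simpa using hf
  have hline : HasDerivAt (fun t : ℝ => f ((0 : E) + t • δ)) (φ δ) 0 := hf'.comp_hasDerivAt (0 : ℝ) hl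
  exact (isLocalMin_line_of_isLocalMinOn hmin hδ).hasDerivAt_eq_zero hline

/-- **The functional (74) has Fréchet derivative `⟨·, J⟩` at `A′ = 0`** — «the first order term is the same as before and
equal to ⟨A′, J⟩» (p. 290) — whenever `HD(A′)` is of second order near `0` (`‖HD(A′)‖ ≦ K‖A′‖²`: (55)–(56) with (46)),
`Δ_π` is a bounded operator and `V₀` is at least of second order near `0` (`|V₀(X)| ≦ K₀‖X‖²`; print: «begins with a third
order polynomial», (26), (31)). [cite: Balaban1985Variational, (74) p.289, (78)–(81) p.290] -/
theorem hasFDerivAt_functional74_zero (A0 : ℝ) (J : E) (Δπ : E →L[ℝ] E) {HD : E → E} {V₀ : E → ℝ}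
    {K K₀ r : ℝ} (hr : 0 < r) (hK : 0 ≤ K) (hK₀ : 0 ≤ K₀)
    (hHD : ∀ A : E, ‖A‖ < r → ‖HD A‖ ≤ K * ‖A‖ ^ 2)
    (hV₀ : ∀ X : E, ‖X‖ < r → |V₀ X| ≤ K₀ * ‖X‖ ^ 2) :
    HasFDerivAt (functional74 A0 J (Δπ : E →ₗ[ℝ] E) HD V₀) (innerSL ℝ J) 0 := by
  set rest : E → ℝ := fun A => -⟪HD A, J⟫_ℝ + 1 / 2 * ⟪A - HD A, Δπ (A - HD A)⟫_ℝ + V₀ (A - HD A)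
    with hrest
  have hsplit : ∀ A, functional74 A0 J (Δπ : E →ₗ[ℝ] E) HD V₀ A = (A0 + ⟪A, J⟫_ℝ) + rest A := by
    intro A
    simp only [functional74, hrest, inner_sub_left, ContinuousLinearMap.coe_coe]
    ring
  have hlin : HasFDerivAt (fun A : E => A0 + ⟪A, J⟫_ℝ) (innerSL ℝ J) 0 := by
    have h := ((innerSL ℝ J).hasFDerivAt (x := (0 : E))).const_add A0
    refine h.congr_of_eventuallyEq (Filter.Eventually.of_forall fun A => ?_)
    simp only [innerSL_apply_apply]
    rw [real_inner_comm J A]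
  have hrest' : HasFDerivAt rest (0 : E →L[ℝ] ℝ) 0 := by
    refine hasFDerivAt_zero_of_eventually_norm_le_sq
      (C := K * ‖J‖ + 1 / 2 * ‖Δπ‖ * (1 + K) ^ 2 + K₀ * (1 + K) ^ 2) ?_
    have hK1 : 0 < 1 + K := by linarith
    have hρ : 0 < min r (min 1 (r / (1 + K))) := lt_min hr (lt_min one_pos (div_pos hr hK1))
    filter_upwards [Metric.ball_mem_nhds (0 : E) hρ] with A hA
    rw [mem_ball_zero_iff, lt_min_iff, lt_min_iff] at hA
    obtain ⟨hAr, hA1, hAK⟩ := hA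
    have h1 : ‖HD A‖ ≤ K * ‖A‖ ^ 2 := hHD A hAr
    have hsq : ‖A‖ ^ 2 ≤ ‖A‖ := by nlinarith [norm_nonneg A]
    have h1' : ‖HD A‖ ≤ K * ‖A‖ := h1.trans (mul_le_mul_of_nonneg_left hsq hK)
    have hX : ‖A - HD A‖ ≤ (1 + K) * ‖A‖ := by
      calc ‖A - HD A‖ ≤ ‖A‖ + ‖HD A‖ := norm_sub_le _ _
        _ ≤ ‖A‖ + K * ‖A‖ := by linarith
        _ = (1 + K) * ‖A‖ := by ring
    have hXr : ‖A - HD A‖ < r := by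
      have : (1 + K) * ‖A‖ < (1 + K) * (r / (1 + K)) := mul_lt_mul_of_pos_left hAK hK1
      rw [mul_div_cancel₀ _ hK1.ne'] at this
      exact hX.trans_lt this
    have b1 : |⟪HD A, J⟫_ℝ| ≤ K * ‖J‖ * ‖A‖ ^ 2 := by
      calc |⟪HD A, J⟫_ℝ| ≤ ‖HD A‖ * ‖J‖ := abs_real_inner_le_norm _ _
        _ ≤ K * ‖A‖ ^ 2 * ‖J‖ := mul_le_mul_of_nonneg_right h1 (norm_nonneg J)
        _ = K * ‖J‖ * ‖A‖ ^ 2 := by ring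
    have b2 : |1 / 2 * ⟪A - HD A, Δπ (A - HD A)⟫_ℝ| ≤ 1 / 2 * ‖Δπ‖ * (1 + K) ^ 2 * ‖A‖ ^ 2 := by
      rw [abs_mul, abs_of_pos (by norm_num : (0 : ℝ) < 1 / 2)]
      calc 1 / 2 * |⟪A - HD A, Δπ (A - HD A)⟫_ℝ| ≤ 1 / 2 * (‖A - HD A‖ * ‖Δπ (A - HD A)‖) := by
            gcongr; exact abs_real_inner_le_norm _ _
        _ ≤ 1 / 2 * (‖A - HD A‖ * (‖Δπ‖ * ‖A - HD A‖)) := by gcongr; exact Δπ.le_opNorm _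
        _ = 1 / 2 * ‖Δπ‖ * ‖A - HD A‖ ^ 2 := by ring
        _ ≤ 1 / 2 * ‖Δπ‖ * ((1 + K) * ‖A‖) ^ 2 := by gcongr
        _ = 1 / 2 * ‖Δπ‖ * (1 + K) ^ 2 * ‖A‖ ^ 2 := by ring
    have b3 : |V₀ (A - HD A)| ≤ K₀ * (1 + K) ^ 2 * ‖A‖ ^ 2 := by
      calc |V₀ (A - HD A)| ≤ K₀ * ‖A - HD A‖ ^ 2 := hV₀ _ hXr
        _ ≤ K₀ * ((1 + K) * ‖A‖) ^ 2 := by gcongr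
        _ = K₀ * (1 + K) ^ 2 * ‖A‖ ^ 2 := by ring
    rw [Real.norm_eq_abs]
    calc |rest A| = |-⟪HD A, J⟫_ℝ + 1 / 2 * ⟪A - HD A, Δπ (A - HD A)⟫_ℝ + V₀ (A - HD A)| := by rw [hrest]
      _ ≤ |-⟪HD A, J⟫_ℝ + 1 / 2 * ⟪A - HD A, Δπ (A - HD A)⟫_ℝ| + |V₀ (A - HD A)| := abs_add_le _ _
      _ ≤ |-⟪HD A, J⟫_ℝ| + |1 / 2 * ⟪A - HD A, Δπ (A - HD A)⟫_ℝ| + |V₀ (A - HD A)| := by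
          gcongr; exact abs_add_le _ _
      _ ≤ K * ‖J‖ * ‖A‖ ^ 2 + 1 / 2 * ‖Δπ‖ * (1 + K) ^ 2 * ‖A‖ ^ 2 + K₀ * (1 + K) ^ 2 * ‖A‖ ^ 2 := by
          rw [abs_neg]; gcongr
      _ = (K * ‖J‖ + 1 / 2 * ‖Δπ‖ * (1 + K) ^ 2 + K₀ * (1 + K) ^ 2) * ‖A‖ ^ 2 := by ring
  have h := hlin.add hrest'
  rw [add_zero] at h
  exact h.congr_of_eventuallyEq (Filter.Eventually.of_forall fun A => hsplit A)

/-- **(170) from the minimality of `U_k` in the expansion (74)** («If we take such a configuration as U₀ in the expansion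
(74), then Eqs. (82), (99) are satisfied for A′ = 0, hence we have ⟨δA′, J⟩ = 0 for δA′: Q(U_k)δA′ = 0,
R(U_k)D^{η*}_{U_k}δA′ = 0»): if the functional (74) has a local minimum at `A′ = 0` on the tangent space (83)
(`QδA′ = 0`, `RD*δA′ = 0` — the constraints (75)–(76) are linear since `RD*H = 0`, (45)), with `HD` of second order, `Δ_π`
bounded and `V₀` at least of second order near `0`, then `⟨δA′, J⟩ = 0` on that space.
[cite: Balaban1985Variational, (170) p.305, (74)–(76) p.289, (77) p.290] -/
theorem eq170_of_isLocalMinOn_74 (A0 : ℝ) (J : E) (Δπ : E →L[ℝ] E) {HD : E → E} {V₀ : E → ℝ}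
    {K K₀ r : ℝ} (hr : 0 < r) (hK : 0 ≤ K) (hK₀ : 0 ≤ K₀)
    (hHD : ∀ A : E, ‖A‖ < r → ‖HD A‖ ≤ K * ‖A‖ ^ 2)
    (hV₀ : ∀ X : E, ‖X‖ < r → |V₀ X| ≤ K₀ * ‖X‖ ^ 2)
    (Q : E →ₗ[ℝ] F) (R : S →ₗ[ℝ] S) (Dstar : E →ₗ[ℝ] S)
    (hmin : IsLocalMinOn (functional74 A0 J (Δπ : E →ₗ[ℝ] E) HD V₀) (tangent83 Q R Dstar : Set E) 0) :
    ∀ δ : E, Q δ = 0 → R (Dstar δ) = 0 → ⟪δ, J⟫_ℝ = 0 := by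
  intro δ hQ hR
  have hδ : δ ∈ tangent83 Q R Dstar := (mem_tangent83_iff Q R Dstar δ).2 ⟨hQ, hR⟩
  have h := apply_eq_zero_of_isLocalMinOn (hasFDerivAt_functional74_zero A0 J Δπ hr hK hK₀ hHD hV₀) hmin hδ
  rw [innerSL_apply_apply] at h
  rwa [real_inner_comm] at h

end Functional74

/-! ## §6 (v1.2) «the corresponding formulas (176), (177)» for the representation (179)–(180) -/

section Representation179

variable {𝒳 𝒴 𝒵 : Type*} [NormedAddCommGroup 𝒳] [NormedSpace ℂ 𝒳] [NormedAddCommGroup 𝒴] [NormedSpace ℂ 𝒴]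
  [NormedAddCommGroup 𝒵] [NormedSpace ℂ 𝒵]
variable {𝒢 : 𝒵 →L[ℂ] 𝒴} {W : 𝒴 → 𝒵} {D2 : 𝒴 →L[ℂ] 𝒵} {H₀ : 𝒳 →L[ℂ] 𝒴} {B₀ θ C₄ a₃ j a ε₄ : ℝ}

variable [CompleteSpace 𝒴]

/-- `𝒜₀(0) = 0` in the representation (179)–(180) as well (`B = 0`: source `−Δ⁽²⁾H₀0 = 0`, shift `H₀0 = 0`).
[cite: Balaban1985Variational, (179)–(180) p.306, Prop. 6 p.295] -/
theorem solA180_zero (R : Regime 𝒢 0 W B₀ θ C₄ a₃ j a ε₄) (hj : 0 ≤ j) (ha : 0 < a) :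
    solA180 𝒢 W D2 H₀ ε₄ 0 = 0 := by
  rw [solA180_def, map_zero, map_zero, neg_zero]
  exact R.solA_zero hj ha

variable [CompleteSpace 𝒳] [CompleteSpace 𝒵]

/-- **(176) for (180)** («an expansion of the solution 𝒜₀ can be generated in the same way as for (175), i.e. we have the
corresponding formulas (176), (177)», p. 306): in the representation (179)–(180), where `−Δ⁽²⁾H₀B` enters as a source,
`(δ/δB)𝒜₀(0) = G̃Δ⁽²⁾H₀` — (183) at `B = 0` with `𝒜₀(0) + H₀0 = 0` and `((δ²/δA′²)V)(0) = 0`.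
[cite: Balaban1985Variational, (180) p.306, (183) p.307] -/
theorem fderiv_solA180_zero (R : Regime 𝒢 0 W B₀ θ C₄ a₃ j a ε₄) (hWa : AnalyticOnNhd ℂ W {Y : 𝒴 | ‖Y‖ < a₃})
    (hj : 0 < j) (ha : 0 < a) : fderiv ℂ (solA180 𝒢 W D2 H₀ ε₄) 0 = 𝒢 ∘L (D2 ∘L H₀) := by
  have hJ : ‖D2 (H₀ (0 : 𝒳))‖ < j := by simpa using hj
  have h𝔄 : ‖H₀ (0 : 𝒳)‖ < a := by simpa using ha
  have ha₃ : 0 < a₃ := by linarith [R.dom, R.ε₄_nonneg]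
  have h := eq183 R hWa hJ h𝔄
  rw [solA180_zero R hj.le ha, map_zero, add_zero, fderiv_W_zero R.quad ha₃] at h
  simpa using h

/-- (176) for (180) as `HasFDerivAt`. [cite: Balaban1985Variational, (180) p.306, (183) p.307] -/
theorem hasFDerivAt_solA180_zero (R : Regime 𝒢 0 W B₀ θ C₄ a₃ j a ε₄)
    (hWa : AnalyticOnNhd ℂ W {Y : 𝒴 | ‖Y‖ < a₃}) (hj : 0 < j) (ha : 0 < a) :
    HasFDerivAt (solA180 𝒢 W D2 H₀ ε₄) (𝒢 ∘L (D2 ∘L H₀)) 0 := by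
  have hJ : ‖D2 (H₀ (0 : 𝒳))‖ < j := by simpa using hj
  have h𝔄 : ‖H₀ (0 : 𝒳)‖ < a := by simpa using ha
  have h := hasFDerivAt_solA180 R hWa hJ h𝔄
  rwa [fderiv_solA180_zero R hWa hj ha] at h

/-- **(177) for (179)**: in the representation `𝓗 = 𝒜₀ + H₀B − HD(𝒜₀ + H₀B)` the chart has Fréchet derivative
`H₀ + G̃Δ⁽²⁾H₀` at `B = 0` (for every Sect. C map with derivative `1` at `0`) — the first order term of the «corresponding
formula (177)». [cite: Balaban1985Variational, (179)–(180) p.306, (182) p.307] -/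
theorem hasFDerivAt_chartH179_zero (R : Regime 𝒢 0 W B₀ θ C₄ a₃ j a ε₄)
    (hWa : AnalyticOnNhd ℂ W {Y : 𝒴 | ‖Y‖ < a₃}) (hj : 0 < j) (ha : 0 < a) {Tm : 𝒴 → 𝒴}
    (hTm : HasFDerivAt Tm (ContinuousLinearMap.id ℂ 𝒴) 0) :
    HasFDerivAt (chartH179 𝒢 W D2 H₀ Tm ε₄) (𝒢 ∘L (D2 ∘L H₀) + H₀) 0 := by
  have hJ : ‖D2 (H₀ (0 : 𝒳))‖ < j := by simpa using hj
  have h𝔄 : ‖H₀ (0 : 𝒳)‖ < a := by simpa using ha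
  have hTm' : HasFDerivAt Tm (ContinuousLinearMap.id ℂ 𝒴) (solA180 𝒢 W D2 H₀ ε₄ 0 + H₀ 0) := by
    rwa [solA180_zero R hj.le ha, map_zero, add_zero]
  have h := hasFDerivAt_chartH179 R hWa hJ h𝔄 hTm'
  rwa [fderiv_solA180_zero R hWa hj ha, ContinuousLinearMap.id_comp] at h

/-- … in particular for the Sect. C map `A′ ↦ A′ − HD(A′)` with `D′(0) = 0`.
[cite: Balaban1985Variational, (179) p.306, (55)–(56) p.286] -/
theorem hasFDerivAt_chartH179_zero_of_D {𝒲 : Type*} [NormedAddCommGroup 𝒲] [NormedSpace ℂ 𝒲]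
    (R : Regime 𝒢 0 W B₀ θ C₄ a₃ j a ε₄) (hWa : AnalyticOnNhd ℂ W {Y : 𝒴 | ‖Y‖ < a₃}) (hj : 0 < j) (ha : 0 < a)
    {D : 𝒴 → 𝒲} (H : 𝒲 →L[ℂ] 𝒴) (hD : HasFDerivAt D (0 : 𝒴 →L[ℂ] 𝒲) 0) :
    HasFDerivAt (chartH179 𝒢 W D2 H₀ (fun Y : 𝒴 => Y - H (D Y)) ε₄) (𝒢 ∘L (D2 ∘L H₀) + H₀) 0 := by
  refine hasFDerivAt_chartH179_zero R hWa hj ha ?_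
  have h := (hasFDerivAt_id (𝕜 := ℂ) (0 : 𝒴)).sub (H.hasFDerivAt.comp (0 : 𝒴) hD)
  rw [ContinuousLinearMap.comp_zero, sub_zero] at h
  exact h

/-- The action along the chart (179) has derivative `φ ∘ (G̃Δ⁽²⁾H₀ + H₀)` at `B = 0` for any `𝔉` with derivative `φ` at `0`.
[cite: Balaban1985Variational, (179)–(180) p.306, (81)–(84) p.290] -/
theorem hasFDerivAt_action_chart179_zero (R : Regime 𝒢 0 W B₀ θ C₄ a₃ j a ε₄)
    (hWa : AnalyticOnNhd ℂ W {Y : 𝒴 | ‖Y‖ < a₃}) (hj : 0 < j) (ha : 0 < a) {𝔉 : 𝒴 → ℝ} {φ : 𝒴 →L[ℝ] ℝ}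
    (h𝔉 : HasFDerivAt 𝔉 φ 0) :
    HasFDerivAt (fun B : 𝒳 => 𝔉 (solA180 𝒢 W D2 H₀ ε₄ B + H₀ B))
      (φ ∘L ((𝒢 ∘L (D2 ∘L H₀) + H₀).restrictScalars ℝ)) 0 := by
  have h1 : HasFDerivAt (fun B : 𝒳 => solA180 𝒢 W D2 H₀ ε₄ B + H₀ B) (𝒢 ∘L (D2 ∘L H₀) + H₀) 0 :=
    (hasFDerivAt_solA180_zero R hWa hj ha).add H₀.hasFDerivAt
  have h1' : HasFDerivAt (fun B : 𝒳 => solA180 𝒢 W D2 H₀ ε₄ B + H₀ B)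
      ((𝒢 ∘L (D2 ∘L H₀) + H₀).restrictScalars ℝ) 0 := h1.restrictScalars ℝ
  have h0 : solA180 𝒢 W D2 H₀ ε₄ 0 + H₀ 0 = 0 := by rw [solA180_zero R hj.le ha, map_zero, add_zero]
  have h𝔉' : HasFDerivAt 𝔉 φ (solA180 𝒢 W D2 H₀ ε₄ 0 + H₀ 0) := by rwa [h0]
  exact h𝔉'.comp 0 h1'

end Representation179

/-! ## §7 (v1.3) The other two «orthogonality relations» of [Balaban1985UV3] (53), located in [7] -/

section Orthogonality53

open Literature.MathematicalPhysics.QuantumFieldTheory.Balaban1983to89.B11Eq127EulerLagrange (laplaceA)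
open Literature.MathematicalPhysics.QuantumFieldTheory.Balaban1983to89.B11Eq129Minimizer (hOp)
open Literature.MathematicalPhysics.QuantumFieldTheory.Balaban1983to89.B11Eq101Translation (inner_delta1_H1_eq_zero)

variable {E F : Type*} [NormedAddCommGroup E] [InnerProductSpace ℝ E] [NormedAddCommGroup F]
  [InnerProductSpace ℝ F]
variable {S : Type*} [AddCommGroup S] [Module ℝ S]
variable {Z : Type*} [AddCommGroup Z] [Module ℝ Z]

/-- «Q𝔊 = 0, RD*𝔊 = 0» (p. 294: the operator `𝔊 = G₁𝔓*` maps into the space (109) `QA₁ = 0, RD*A₁ = 0`) and (170)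
(`J` orthogonal to that space at a minimal `U₀ = U_k`) give `⟨𝔊z, J⟩ = 0` for every source `z`.
[cite: Balaban1985Variational, (109)–(111) p.294, (170) p.305] -/
theorem inner_frakG_J_eq_zero (Q : E →ₗ[ℝ] F) (R : S →ₗ[ℝ] S) (Dstar : E →ₗ[ℝ] S) {J : E}
    (h170 : ∀ δ : E, Q δ = 0 → R (Dstar δ) = 0 → ⟪δ, J⟫_ℝ = 0) {𝔊 : Z →ₗ[ℝ] E}
    (hQ𝔊 : ∀ z, Q (𝔊 z) = 0) (hR𝔊 : ∀ z, R (Dstar (𝔊 z)) = 0) (z : Z) : ⟪𝔊 z, J⟫_ℝ = 0 :=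
  h170 _ (hQ𝔊 z) (hR𝔊 z)

/-- A solution `𝒜₁` of (175) `𝒜₁ + 𝔊((δ/δA′)V)(𝒜₁ + H₁B) = 0` lies in the space (109): `Q𝒜₁ = 0`, `RD*𝒜₁ = 0` (it is in the
range of `𝔊`). [cite: Balaban1985Variational, (109)–(111) p.294, (175) p.305] -/
theorem solution175_mem_tangent (Q : E →ₗ[ℝ] F) (R : S →ₗ[ℝ] S) (Dstar : E →ₗ[ℝ] S) {𝔊 : Z →ₗ[ℝ] E}
    (hQ𝔊 : ∀ z, Q (𝔊 z) = 0) (hR𝔊 : ∀ z, R (Dstar (𝔊 z)) = 0) {𝒜 : E} {w : Z} (h175 : 𝒜 + 𝔊 w = 0) :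
    Q 𝒜 = 0 ∧ R (Dstar 𝒜) = 0 := by
  have h𝒜 : 𝒜 = 𝔊 (-w) := by rw [map_neg]; exact eq_neg_of_add_eq_zero_left h175
  rw [h𝒜]
  exact ⟨hQ𝔊 _, hR𝔊 _⟩

/-- **The second orthogonality relation of [Balaban1985UV3] (53), `⟨𝓗₁, J⟩ = 0`, located:** the non-linear part `𝒜₁` of the
representative (174) solves (175), hence lies in the space (109) (range of `𝔊`, «Q𝔊 = 0, RD*𝔊 = 0» p. 294), on which `J`
vanishes by (170) at the minimal base point. [cite: Balaban1985Variational, (170) p.305, (175) p.305, (109)–(111) p.294;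
Balaban1985UV3, (53) p.269] -/
theorem inner_solution175_J_eq_zero (Q : E →ₗ[ℝ] F) (R : S →ₗ[ℝ] S) (Dstar : E →ₗ[ℝ] S) {J : E}
    (h170 : ∀ δ : E, Q δ = 0 → R (Dstar δ) = 0 → ⟪δ, J⟫_ℝ = 0) {𝔊 : Z →ₗ[ℝ] E}
    (hQ𝔊 : ∀ z, Q (𝔊 z) = 0) (hR𝔊 : ∀ z, R (Dstar (𝔊 z)) = 0) {𝒜 : E} {w : Z} (h175 : 𝒜 + 𝔊 w = 0) :
    ⟪𝒜, J⟫_ℝ = 0 := by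
  obtain ⟨hQ, hR⟩ := solution175_mem_tangent Q R Dstar hQ𝔊 hR𝔊 h175
  exact h170 _ hQ hR

/-- **The third orthogonality relation of [Balaban1985UV3] (53), the cross term `⟨H₁B′, Δ₁𝓗₁⟩ = 0`, generic letters:** if
`Δ₁` is symmetric and `⟨δA′, Δ₁H₁b⟩ = 0` for all admissible `δA′` («the identity ⟨δA′, Δ₁H₁B⟩ = 0 following from the
definitions of H₁», p. 293) then `⟨H₁b, Δ₁X⟩ = 0` for every admissible `X` (e.g. `X = 𝒜₁`, admissible by
`solution175_mem_tangent`). [cite: Balaban1985Variational, (101) p.293; Balaban1985UV3, (53) p.269] -/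
theorem inner_H1_delta1_eq_zero {Δ₁ : E →ₗ[ℝ] E} (hΔ : ∀ x y, ⟪Δ₁ x, y⟫_ℝ = ⟪x, Δ₁ y⟫_ℝ) {FB : Type*}
    {H₁op : FB → E} {P : E → Prop} (h293 : ∀ δ : E, P δ → ∀ b : FB, ⟪δ, Δ₁ (H₁op b)⟫_ℝ = 0) {X : E} (hX : P X)
    (b : FB) : ⟪H₁op b, Δ₁ X⟫_ℝ = 0 := by
  rw [← hΔ (H₁op b) X, real_inner_comm X (Δ₁ (H₁op b))]
  exact h293 X hX b

/-- The cross term with the p. 293 identity SUPPLIED (`B11Eq101Translation.inner_delta1_H1_eq_zero`): for `H₁b = G₁Q*(QG₁Q*)⁻¹b`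
with `Δ_{1,a}G₁ = 1`, `⟨x, Q*y⟩ = ⟨Qx, y⟩`, `RD*H₁b = 0` and `Δ₁` symmetric, `⟨H₁b, Δ₁X⟩ = 0` whenever `QX = 0` — in particular for
`X = 𝒜₁` of (175). [cite: Balaban1985Variational, (101) p.293, (109) p.294; Balaban1985UV3, (53) p.269] -/
theorem inner_hOp_delta1_eq_zero {Δ₁ G₁ : E →ₗ[ℝ] E} {Q : E →ₗ[ℝ] F} {Qadj : F →ₗ[ℝ] E} {Kinv : F →ₗ[ℝ] F}
    (D : S →ₗ[ℝ] E) (R : S →ₗ[ℝ] S) (Dstar : E →ₗ[ℝ] S) (a : ℝ)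
    (hΔ : ∀ x y, ⟪Δ₁ x, y⟫_ℝ = ⟪x, Δ₁ y⟫_ℝ) (hadj : ∀ (x : E) (y : F), ⟪x, Qadj y⟫_ℝ = ⟪Q x, y⟫_ℝ)
    (hΔG : ∀ x : E, laplaceA Δ₁ D R Dstar Q Qadj a (G₁ x) = x)
    (hRD : ∀ b : F, R (Dstar (hOp G₁ Qadj Kinv b)) = 0) {X : E} (hQX : Q X = 0) (b : F) :
    ⟪hOp G₁ Qadj Kinv b, Δ₁ X⟫_ℝ = 0 :=
  inner_H1_delta1_eq_zero hΔ (P := fun δ : E => Q δ = 0)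
    (fun _ hδ b' => inner_delta1_H1_eq_zero D R Dstar a hadj hΔG b' (hRD b') hδ) hQX b

end Orthogonality53

end Literature.MathematicalPhysics.QuantumFieldTheory.Balaban1983to89.B11Eq177FirstOrder
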